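import Summits.QuantumFields.BalabanUV.Beta.GAN24.FibreRateFeedSums
import Summits.QuantumFields.BalabanUV.Beta.GAN24.FibreRateTBlockSum

/-!
# `BalabanUV.Beta.GAN24.FibreRateFeedTotal` — binder row G-an2-4 / (CONV-C), road P1-fibre, self-row **P1-Y11t\*** (alias-sum side of p1 row L11,
# division agreed with the L11 owner in CLAIMS l.3039/l.3094), part 8: the source-side per-label lemmas and THE FOUR FEED-SIDE SUMS
# `R_φ, R_c, S_φ, S_c` — two-level rates (matched labels + new-label tail), `p`-orders displayed

NOT IN PRINT; OUR PROOF ATTEMPT.  HONEST FRAMING (cell contract, verbatim): «discharging `BetaPertH` makes Bałaban's UV stability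
UNCONDITIONAL — a real constructive-QFT result; it is NOT the continuum limit and NOT the Clay problem.»  HONEST DEPENDENCY (verbatim):
«continuum YM on T⁴ ⇐ BetaPertH ∧ nine spine estimates (0/9 proved); BetaPertH ⇐ (D1) ∧ (D4) ∧ CAP+tail; G-an2-4 gates asym, D1 and
NE2/3/4.»  [folklore] parts 4–7b BY NAME (`FibreRateTBlockSum.sum_prod_wMaj_le`/`sq_le_momSq_of_mem_newLabels`, `FibreRateKingSummand`,
`FibreRateFeedSums`, `AliasReindex.norm_sum_sub_sum_le_of_rates`); four harmless data `def`s (the sums `rPhiSum rCSum sPhiSum sCSum`); NO cited fact,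
NO `def … : Prop`, NO wall binder, NO unit re-typed (unit `M^{D+1}/N^{D+4}` displayed).  NOT summit progress; nothing of (CONV-C)'s K-slot is discharged.

## What is proved (real `pr ∈ [−π,π]^D`, `N = M·Lc ≥ 2`, `M, Lc ≥ 1`, next level `(N·Lc, N)`; `C := coordConst Lc`)
* §1 `sPhiNorm_label`, `sCNorm_label` (twins of part 7b's `rPhiNorm_label`, `rCNorm_label`).
* §2 `norm_sum_two_level_of_label` (generic: per-label rate `Cr·W/N²` + new-label bound `Ct·W/N²` ⇒ `(Cr+Ct)·C^D/N²`), every label has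
  `momSq pr ≤ D·momSq (qlab pr m)` (`momSq_le_mul_momSq_qlab`).
* §3 **THE SUMS**: `‖rPhiSum (N·Lc) N − rPhiSum N M‖, ‖sPhiSum (N·Lc) N − sPhiSum N M‖ ≤ 284814·C^D/N²` (every `pr`), and for `pr ≠ 0`
  `‖rCSum (N·Lc) N − rCSum N M‖, ‖sCSum (N·Lc) N − sCSum N M‖ ≤ (567648·√D/√(momSq pr) + 1296)·C^D/N²` (`p`-order `−1`, displayed).
-/

noncomputable section

open Complex Finset
open scoped BigOperators Real ComplexConjugate
open Literature.Probability.LatticeModels (TorusSite)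
open Literature.MathematicalPhysics.QuantumFieldTheory.King1986 (latticeSymbol momSq momSq_nonneg pi_le_abs_add)
open Literature.MathematicalPhysics.QuantumFieldTheory.Balaban1983to89.B4Strip (ofRealVec)
open Summit.QuantumFields.BalabanUV.Beta.GAN24.AliasReindex (srep lift newLabels srep_lift natAbs_srep_le norm_sum_sub_sum_le_of_rates)
open Summit.QuantumFields.BalabanUV.Beta.GAN24.FibreRateTBlock (qlab)
open Summit.QuantumFields.BalabanUV.Beta.GAN24.FibreRateTBlockRate
open Summit.QuantumFields.BalabanUV.Beta.GAN24.FibreRateTBlockLabel (qlab_zone)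
open Summit.QuantumFields.BalabanUV.Beta.GAN24.FibreRateTBlockSum (coordConst one_le_coordConst sum_prod_wMaj_le sq_le_momSq_of_mem_newLabels)
open Summit.QuantumFields.BalabanUV.Beta.GAN24.FibreRateKingSummand (xGen norm_king_le norm_king_two_level_le)
open Summit.QuantumFields.BalabanUV.Beta.GAN24.FibreRateFeedTerms
open Summit.QuantumFields.BalabanUV.Beta.GAN24.FibreRateFeedFactors
open Summit.QuantumFields.BalabanUV.Beta.GAN24.FibreRateFeedSums

namespace Summit.QuantumFields.BalabanUV.Beta.GAN24.FibreRateFeedTotal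

variable {D : ℕ}

/-! ## §1 The source-side per-label lemmas -/

/-- [folklore] If `q = 0` every generic bracket vanishes. -/
theorem xGen_eq_zero_of_eq_zero {q : Fin D → ℝ} (hq0 : q = 0) (N' : ℕ) (g n : ℂ) : xGen N' q g n = 0 := by
  unfold xGen
  have : latticeSymbol ((N' : ℝ)⁻¹) 0 q = 0 := by
    rw [hq0]; unfold latticeSymbol; simp [Literature.MathematicalPhysics.QuantumFieldTheory.King1986.fdSymbol]
  rw [this]; simp

section Label

variable {N M Lc : ℕ} [NeZero N] (hN2 : 2 ≤ N) (hM : 0 < M) (hLc : 0 < Lc) (hNM : N = M * Lc) {pr : Fin D → ℝ} (hpr : ∀ i, |pr i| ≤ π)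
include hN2 hM hLc hNM hpr

/-- [folklore] **`S_φ` PER LABEL**: bound `≤ 666·W/momSq` (`q ≠ 0`) and rate `≤ 284148·W/N²` (all labels). -/
theorem sPhiNorm_label [NeZero (N * Lc)] (m : TorusSite D N) (l' l : Fin D) (y' : Fin D → ℤ) :
    (qlab pr m ≠ 0 → ‖sPhiNorm N M pr m l' l y'‖ ≤ 666 * (∏ i, wMaj Lc (qlab pr m i)) / momSq (qlab pr m)) ∧
    ‖sPhiNorm (N * Lc) N pr (lift (N * Lc) m) l' l y' - sPhiNorm N M pr m l' l y'‖ ≤ 284148 * (∏ i, wMaj Lc (qlab pr m i)) / (N : ℝ) ^ 2 := by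
  have hN : 0 < N := by omega
  have hNLc : N ≤ N * Lc := Nat.le_mul_of_pos_right N hLc
  have hq := qlab_zone hN2 hpr m
  have hlab : qlab pr (lift (N * Lc) m) = qlab pr m := by funext i; simp only [qlab, srep_lift hNLc]
  have hW0 : 0 ≤ ∏ i, wMaj Lc (qlab pr m i) := Finset.prod_nonneg fun i _ => wMaj_nonneg _ _
  set q := qlab pr m with hqdef
  have hf : ∀ i, ‖mfacS N M (q i)‖ ≤ 1 * wMaj Lc (q i) := fun i => by rw [one_mul]; exact norm_mfacS_le hM hLc hNM (hq i)
  have hf' : ∀ i, ‖mfacS (N * Lc) N (q i)‖ ≤ 1 * wMaj Lc (q i) := fun i => by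
    rw [one_mul]; exact norm_mfacS_le hN hLc rfl (zone_mono (by exact_mod_cast hNLc) (hq i))
  have hfr : ∀ i, ‖mfacS (N * Lc) N (q i) - mfacS N M (q i)‖ ≤ 6 * q i ^ 2 / (N : ℝ) ^ 2 * (1 * wMaj Lc (q i)) := fun i => by
    rw [one_mul]; exact norm_mfacS_two_level_le hM hLc hNM (hq i)
  have hg : ‖(if l' = l then mfacS N M (q l) else 0)‖ ≤ 1 := by
    split_ifs
    · exact (norm_mfacS_le hM hLc hNM (hq l)).trans (wMaj_le_one _ _)
    · simp
  have hg' : ‖(if l' = l then mfacS (N * Lc) N (q l) else 0)‖ ≤ 1 := by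
    split_ifs
    · exact (norm_mfacS_le hN hLc rfl (zone_mono (by exact_mod_cast hNLc) (hq l))).trans (wMaj_le_one _ _)
    · simp
  have h6 : (0 : ℝ) ≤ 6 * momSq q / (N : ℝ) ^ 2 := div_nonneg (mul_nonneg (by norm_num) (momSq_nonneg q)) (sq_nonneg _)
  have hgr : ‖(if l' = l then mfacS (N * Lc) N (q l) else 0) - (if l' = l then mfacS N M (q l) else 0)‖ ≤ 6 * momSq q / (N : ℝ) ^ 2 * 1 := by
    split_ifs
    · refine (norm_mfacS_two_level_le hM hLc hNM (hq l)).trans ?_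
      have hql : q l ^ 2 ≤ momSq q := Finset.single_le_sum (fun j _ => sq_nonneg (q j)) (Finset.mem_univ l)
      have h1 : 6 * q l ^ 2 / (N : ℝ) ^ 2 ≤ 6 * momSq q / (N : ℝ) ^ 2 := by gcongr
      exact mul_le_mul h1 (wMaj_le_one Lc (q l)) (wMaj_nonneg Lc (q l)) h6
    · rw [sub_self, norm_zero]; exact mul_nonneg h6 zero_le_one
  have hn := norm_numPhiS_le hLc q l' l
  constructor
  · intro hq0
    rw [sPhiNorm_eq hLc.ne' hM.ne' hNM, norm_mul, norm_neg, norm_srcPhase, one_mul]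
    refine (norm_king_le hN hq hq0 zero_le_one (fun i => wMaj_nonneg _ _) hf hg hn).trans ?_
    have hm : 0 < momSq q := by
      have hN' : (0:ℝ) < N := by exact_mod_cast hN
      exact lt_of_lt_of_le (ell_pos hN' hq hq0) (ell_le_momSq hN'.ne' _)
    rw [one_pow, one_mul]
    have e : 18 * (1:ℝ) / momSq q + 648 * momSq q / momSq q ^ 2 = 666 / momSq q := by field_simp; ring
    rw [e]; exact le_of_eq (by ring)
  · rw [sPhiNorm_eq hLc.ne' hN.ne' rfl, sPhiNorm_eq hLc.ne' hM.ne' hNM, hlab, ← mul_sub, norm_mul, norm_neg, norm_srcPhase, one_mul]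
    rcases eq_or_ne q 0 with hq0 | hq0
    · rw [xGen_eq_zero_of_eq_zero hq0, xGen_eq_zero_of_eq_zero hq0]
      simp only [mul_zero, sub_self, norm_zero]; positivity
    refine (norm_king_two_level_le hN hNLc hq hq0 zero_le_one (fun i => wMaj_nonneg _ _) hf hf' hfr hg hg' hgr hn).trans ?_
    have hm : 0 < momSq q := by
      have hN' : (0:ℝ) < N := by exact_mod_cast hN
      exact lt_of_lt_of_le (ell_pos hN' hq hq0) (ell_le_momSq hN'.ne' _)
    rw [one_pow, one_mul]
    have e : (324 * (1:ℝ) + 283824 * momSq q / momSq q) = 284148 := by field_simp; ring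
    rw [e]; apply le_of_eq; ring

/-- [folklore] **`S_c` PER LABEL**: bound `≤ 1296·W/(momSq·√momSq)` (`q ≠ 0`) and rate `≤ 567648·W/(√momSq·N²)` (all labels). -/
theorem sCNorm_label [NeZero (N * Lc)] (m : TorusSite D N) (l : Fin D) (y' : Fin D → ℤ) :
    (qlab pr m ≠ 0 → ‖sCNorm N M pr m l y'‖ ≤ 1296 * (∏ i, wMaj Lc (qlab pr m i)) / (momSq (qlab pr m) * Real.sqrt (momSq (qlab pr m)))) ∧
    ‖sCNorm (N * Lc) N pr (lift (N * Lc) m) l y' - sCNorm N M pr m l y'‖ ≤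
      567648 * (∏ i, wMaj Lc (qlab pr m i)) / (Real.sqrt (momSq (qlab pr m)) * (N : ℝ) ^ 2) := by
  have hN : 0 < N := by omega
  have hNLc : N ≤ N * Lc := Nat.le_mul_of_pos_right N hLc
  have hq := qlab_zone hN2 hpr m
  have hlab : qlab pr (lift (N * Lc) m) = qlab pr m := by funext i; simp only [qlab, srep_lift hNLc]
  have hW0 : 0 ≤ ∏ i, wMaj Lc (qlab pr m i) := Finset.prod_nonneg fun i _ => wMaj_nonneg _ _
  set q := qlab pr m with hqdef
  have hf : ∀ i, ‖mfacS N M (q i)‖ ≤ 1 * wMaj Lc (q i) := fun i => by rw [one_mul]; exact norm_mfacS_le hM hLc hNM (hq i)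
  have hf' : ∀ i, ‖mfacS (N * Lc) N (q i)‖ ≤ 1 * wMaj Lc (q i) := fun i => by
    rw [one_mul]; exact norm_mfacS_le hN hLc rfl (zone_mono (by exact_mod_cast hNLc) (hq i))
  have hfr : ∀ i, ‖mfacS (N * Lc) N (q i) - mfacS N M (q i)‖ ≤ 6 * q i ^ 2 / (N : ℝ) ^ 2 * (1 * wMaj Lc (q i)) := fun i => by
    rw [one_mul]; exact norm_mfacS_two_level_le hM hLc hNM (hq i)
  have hg : ‖(0 : ℂ)‖ ≤ 0 := by simp
  have hgr : ‖(0 : ℂ) - 0‖ ≤ 6 * momSq q / (N : ℝ) ^ 2 * 0 := by simp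
  have hn := (norm_numC_le hLc q l).2
  constructor
  · intro hq0
    rw [sCNorm_eq hLc.ne' hM.ne' hNM, norm_mul, norm_neg, norm_srcPhase, one_mul]
    refine (norm_king_le hN hq hq0 zero_le_one (fun i => wMaj_nonneg _ _) hf hg hn).trans ?_
    have hm : 0 < momSq q := by
      have hN' : (0:ℝ) < N := by exact_mod_cast hN
      exact lt_of_lt_of_le (ell_pos hN' hq hq0) (ell_le_momSq hN'.ne' _)
    have hs : 0 < Real.sqrt (momSq q) := Real.sqrt_pos.2 hm
    have hss : Real.sqrt (momSq q) * Real.sqrt (momSq q) = momSq q := Real.mul_self_sqrt hm.le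
    rw [one_pow, one_mul, mul_zero, zero_div, zero_add]
    have e : (648 : ℝ) * (2 * Real.sqrt (momSq q)) / momSq q ^ 2 = 1296 / (momSq q * Real.sqrt (momSq q)) := by
      rw [div_eq_div_iff (by positivity) (by positivity)]; nlinarith [hss]
    rw [e]; apply le_of_eq; ring
  · rw [sCNorm_eq hLc.ne' hN.ne' rfl, sCNorm_eq hLc.ne' hM.ne' hNM, hlab, ← mul_sub, norm_mul, norm_neg, norm_srcPhase, one_mul]
    rcases eq_or_ne q 0 with hq0 | hq0
    · rw [xGen_eq_zero_of_eq_zero hq0, xGen_eq_zero_of_eq_zero hq0]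
      simp only [mul_zero, sub_self, norm_zero]; positivity
    refine (norm_king_two_level_le hN hNLc hq hq0 zero_le_one (fun i => wMaj_nonneg _ _) hf hf' hfr hg hg hgr hn).trans ?_
    have hm : 0 < momSq q := by
      have hN' : (0:ℝ) < N := by exact_mod_cast hN
      exact lt_of_lt_of_le (ell_pos hN' hq hq0) (ell_le_momSq hN'.ne' _)
    have hs : 0 < Real.sqrt (momSq q) := Real.sqrt_pos.2 hm
    have hss : Real.sqrt (momSq q) * Real.sqrt (momSq q) = momSq q := Real.mul_self_sqrt hm.le
    rw [one_pow, one_mul, mul_zero, zero_add]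
    have e : (283824 : ℝ) * (2 * Real.sqrt (momSq q)) / momSq q = 567648 / Real.sqrt (momSq q) := by
      rw [div_eq_div_iff hm.ne' hs.ne']; nlinarith [hss]
    rw [e]; apply le_of_eq
    have hN' : (N : ℝ) ≠ 0 := by exact_mod_cast hN.ne'
    field_simp

end Label

/-! ## §2 The generic two-level sum and the label geometry -/

section Sum

variable {N Lc : ℕ} [NeZero N] [NeZero (N * Lc)]

/-- [folklore] **GENERIC TWO-LEVEL SUM**: per-label rate `Cr·W(m)/N²` on matched labels and bound `Ct·W(m′)/N²` on the new labels
(`W = Π_i wMaj Lc (qlab · i)`) give `‖Σ′ F′ − Σ F‖ ≤ (Cr + Ct)·coordConst Lc^D/N²`. -/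
theorem norm_sum_two_level_of_label (hLc : 0 < Lc) {pr : Fin D → ℝ} (hpr : ∀ i, |pr i| ≤ π)
    (F : TorusSite D N → ℂ) (F' : TorusSite D (N * Lc) → ℂ) {Cr Ct : ℝ} (hCr : 0 ≤ Cr) (hCt : 0 ≤ Ct)
    (hrate : ∀ m, ‖F' (lift (N * Lc) m) - F m‖ ≤ Cr * (∏ i, wMaj Lc (qlab pr m i)) / (N : ℝ) ^ 2)
    (htail : ∀ m' ∈ newLabels N (N * Lc), ‖F' m'‖ ≤ Ct * (∏ i, wMaj Lc (qlab pr m' i)) / (N : ℝ) ^ 2) :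
    ‖∑ m', F' m' - ∑ m, F m‖ ≤ (Cr + Ct) * coordConst Lc ^ D / (N : ℝ) ^ 2 := by
  have hNLc : N ≤ N * Lc := Nat.le_mul_of_pos_right N hLc
  have hS := sum_prod_wMaj_le Lc N hpr
  have hS' := sum_prod_wMaj_le Lc (N * Lc) hpr
  have hW' : ∀ m' : TorusSite D (N * Lc), 0 ≤ ∏ i, wMaj Lc (qlab pr m' i) := fun m' => Finset.prod_nonneg fun i _ => wMaj_nonneg _ _
  have htail' : ∑ m' ∈ newLabels N (N * Lc), ‖F' m'‖ ≤ Ct * coordConst Lc ^ D / (N : ℝ) ^ 2 := by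
    calc ∑ m' ∈ newLabels N (N * Lc), ‖F' m'‖ ≤ ∑ m' ∈ newLabels N (N * Lc), Ct * (∏ i, wMaj Lc (qlab pr m' i)) / (N : ℝ) ^ 2 :=
          Finset.sum_le_sum htail
      _ ≤ ∑ m' : TorusSite D (N * Lc), Ct * (∏ i, wMaj Lc (qlab pr m' i)) / (N : ℝ) ^ 2 :=
          Finset.sum_le_sum_of_subset_of_nonneg (Finset.subset_univ _) fun m' _ _ => by have := hW' m'; positivity
      _ = Ct * (∑ m' : TorusSite D (N * Lc), ∏ i, wMaj Lc (qlab pr m' i)) / (N : ℝ) ^ 2 := by rw [Finset.mul_sum, Finset.sum_div]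
      _ ≤ Ct * coordConst Lc ^ D / (N : ℝ) ^ 2 := by gcongr
  refine (norm_sum_sub_sum_le_of_rates hNLc F F' _ hrate htail').trans ?_
  calc ∑ m : TorusSite D N, Cr * (∏ i, wMaj Lc (qlab pr m i)) / (N : ℝ) ^ 2 + Ct * coordConst Lc ^ D / (N : ℝ) ^ 2
      = (Cr * ∑ m : TorusSite D N, ∏ i, wMaj Lc (qlab pr m i)) / (N : ℝ) ^ 2 + Ct * coordConst Lc ^ D / (N : ℝ) ^ 2 := by
        rw [Finset.mul_sum, Finset.sum_div]
    _ ≤ Cr * coordConst Lc ^ D / (N : ℝ) ^ 2 + Ct * coordConst Lc ^ D / (N : ℝ) ^ 2 := by gcongr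
    _ = (Cr + Ct) * coordConst Lc ^ D / (N : ℝ) ^ 2 := by ring

omit [NeZero N] [NeZero (N * Lc)] in
/-- [folklore] **EVERY LABEL IS AT LEAST AS LONG AS `pr/√D`**: `momSq pr ≤ D·momSq (qlab pr m)` (`|pr_i| ≤ π`; a class with a nonzero symmetric
coordinate has `|q_i| ≥ π`, the zero class has `q = pr`). -/
theorem momSq_le_mul_momSq_qlab {pr : Fin D → ℝ} (hpr : ∀ i, |pr i| ≤ π) (m : TorusSite D N) : momSq pr ≤ D * momSq (qlab pr m) := by
  by_cases h : ∃ i, srep m i ≠ 0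
  · obtain ⟨i, hi⟩ := h
    have hqi : π ≤ |qlab pr m i| := by
      have := pi_le_abs_add (hpr i) hi
      simpa [qlab] using this
    have hq2 : π ^ 2 ≤ momSq (qlab pr m) := by
      have h1 : π ^ 2 ≤ qlab pr m i ^ 2 := by
        rw [← sq_abs (qlab pr m i)]; exact pow_le_pow_left₀ Real.pi_pos.le hqi 2
      exact h1.trans (Finset.single_le_sum (fun j _ => sq_nonneg (qlab pr m j)) (Finset.mem_univ i))
    calc momSq pr = ∑ j, pr j ^ 2 := rfl
      _ ≤ ∑ _j : Fin D, π ^ 2 := Finset.sum_le_sum fun j _ => by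
          rw [← sq_abs (pr j)]; exact pow_le_pow_left₀ (abs_nonneg _) (hpr j) 2
      _ = D * π ^ 2 := by rw [Finset.sum_const, Finset.card_univ, Fintype.card_fin]; ring
      _ ≤ D * momSq (qlab pr m) := by gcongr
  · push Not at h
    have hq : qlab pr m = pr := by funext i; simp [qlab, h i]
    rw [hq]
    rcases Nat.eq_zero_or_pos D with hD | hD
    · subst hD; simp [momSq]
    · have hD' : (1 : ℝ) ≤ D := by exact_mod_cast hD
      have := momSq_nonneg pr
      nlinarith

end Sum

/-! ## §3 The four feed-side sums -/

section Total

variable {N M Lc : ℕ} [NeZero N] [NeZero (N * Lc)]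

/-- [folklore] `R_φ`-SUM (normalised): `Σ_m rPhiNorm`. -/
def rPhiSum (N M : ℕ) [NeZero N] (pr : Fin D → ℝ) (κ l' : Fin D) (x' : Fin D → ℤ) : ℂ := ∑ m : TorusSite D N, rPhiNorm N M pr m κ l' x'
/-- [folklore] `R_c`-SUM (normalised). -/
def rCSum (N M : ℕ) [NeZero N] (pr : Fin D → ℝ) (κ : Fin D) (x' : Fin D → ℤ) : ℂ := ∑ m : TorusSite D N, rCNorm N M pr m κ x'
/-- [folklore] `S_φ`-SUM (normalised) `= (M^{D+1}/N^{D+4})·srcPhi N p (fhatF l y′) 0 l′` (part 6 `srcPhi_fhatF_eq_sum`). -/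
def sPhiSum (N M : ℕ) [NeZero N] (pr : Fin D → ℝ) (l' l : Fin D) (y' : Fin D → ℤ) : ℂ := ∑ m : TorusSite D N, sPhiNorm N M pr m l' l y'
/-- [folklore] `S_c`-SUM (normalised) `= (M^{D+1}/N^{D+4})·srcC N p (fhatF l y′)`. -/
def sCSum (N M : ℕ) [NeZero N] (pr : Fin D → ℝ) (l : Fin D) (y' : Fin D → ℤ) : ℂ := ∑ m : TorusSite D N, sCNorm N M pr m l y'

omit [NeZero N] in
/-- [folklore] A new label is long: `momSq ≥ N² ≥ 1`, `√momSq ≥ 1`, and the label is nonzero. -/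
theorem newLabel_facts (hN2 : 2 ≤ N) {pr : Fin D → ℝ} (hpr : ∀ i, |pr i| ≤ π) {m' : TorusSite D (N * Lc)}
    (hm' : m' ∈ (newLabels N (N * Lc) : Finset (TorusSite D (N * Lc)))) :
    (N : ℝ) ^ 2 ≤ momSq (qlab pr m') ∧ 1 ≤ Real.sqrt (momSq (qlab pr m')) ∧ qlab pr m' ≠ 0 := by
  have hmom := sq_le_momSq_of_mem_newLabels hN2 hpr hm'
  have h2 : (2 : ℝ) ≤ N := by exact_mod_cast hN2
  have hN1 : (1 : ℝ) ≤ (N : ℝ) ^ 2 := by nlinarith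
  refine ⟨hmom, ?_, ?_⟩
  · rw [show (1:ℝ) = Real.sqrt 1 by simp]; exact Real.sqrt_le_sqrt (hN1.trans hmom)
  · intro h; rw [h] at hmom; simp [momSq] at hmom; nlinarith

variable (hN2 : 2 ≤ N) (hM : 0 < M) (hLc : 0 < Lc) (hNM : N = M * Lc) {pr : Fin D → ℝ} (hpr : ∀ i, |pr i| ≤ π)
include hN2 hM hLc hNM hpr

/-- [folklore] **`R_φ`-SUM TWO-LEVEL RATE**: `‖rPhiSum (N·Lc) N − rPhiSum N M‖ ≤ 284814·coordConst Lc^D/N²` (every real `pr ∈ [−π,π]^D`). -/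
theorem norm_rPhiSum_two_level_le (κ l' : Fin D) (x' : Fin D → ℤ) :
    ‖rPhiSum (N * Lc) N pr κ l' x' - rPhiSum N M pr κ l' x'‖ ≤ 284814 * coordConst Lc ^ D / (N : ℝ) ^ 2 := by
  have hN : 0 < N := by omega
  have hN2' : 2 ≤ N * Lc := le_trans hN2 (Nat.le_mul_of_pos_right N hLc)
  haveI : NeZero (N * Lc * Lc) := ⟨mul_ne_zero (NeZero.ne (N * Lc)) hLc.ne'⟩
  unfold rPhiSum
  have h := norm_sum_two_level_of_label (N := N) hLc hpr (fun m => rPhiNorm N M pr m κ l' x') (fun m' => rPhiNorm (N * Lc) N pr m' κ l' x')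
    (by norm_num : (0:ℝ) ≤ 284148) (by norm_num : (0:ℝ) ≤ 666)
    (fun m => (rPhiNorm_label hN2 hM hLc hNM hpr m κ l' x').2)
    (fun m' hm' => by
      obtain ⟨hmom, -, hq0⟩ := newLabel_facts hN2 hpr hm'
      have hb := (rPhiNorm_label (N := N * Lc) (M := N) (Lc := Lc) hN2' hN hLc rfl hpr m' κ l' x').1 hq0
      have hW : 0 ≤ ∏ i, wMaj Lc (qlab pr m' i) := Finset.prod_nonneg fun i _ => wMaj_nonneg _ _
      exact hb.trans (div_le_div_of_nonneg_left (by positivity) (by positivity) hmom))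
  refine h.trans (le_of_eq ?_); norm_num

/-- [folklore] **`S_φ`-SUM TWO-LEVEL RATE**: `‖sPhiSum (N·Lc) N − sPhiSum N M‖ ≤ 284814·coordConst Lc^D/N²`. -/
theorem norm_sPhiSum_two_level_le (l' l : Fin D) (y' : Fin D → ℤ) :
    ‖sPhiSum (N * Lc) N pr l' l y' - sPhiSum N M pr l' l y'‖ ≤ 284814 * coordConst Lc ^ D / (N : ℝ) ^ 2 := by
  have hN : 0 < N := by omega
  have hN2' : 2 ≤ N * Lc := le_trans hN2 (Nat.le_mul_of_pos_right N hLc)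
  haveI : NeZero (N * Lc * Lc) := ⟨mul_ne_zero (NeZero.ne (N * Lc)) hLc.ne'⟩
  unfold sPhiSum
  have h := norm_sum_two_level_of_label (N := N) hLc hpr (fun m => sPhiNorm N M pr m l' l y') (fun m' => sPhiNorm (N * Lc) N pr m' l' l y')
    (by norm_num : (0:ℝ) ≤ 284148) (by norm_num : (0:ℝ) ≤ 666)
    (fun m => (sPhiNorm_label hN2 hM hLc hNM hpr m l' l y').2)
    (fun m' hm' => by
      obtain ⟨hmom, -, hq0⟩ := newLabel_facts hN2 hpr hm'
      have hb := (sPhiNorm_label (N := N * Lc) (M := N) (Lc := Lc) hN2' hN hLc rfl hpr m' l' l y').1 hq0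
      have hW : 0 ≤ ∏ i, wMaj Lc (qlab pr m' i) := Finset.prod_nonneg fun i _ => wMaj_nonneg _ _
      exact hb.trans (div_le_div_of_nonneg_left (by positivity) (by positivity) hmom))
  refine h.trans (le_of_eq ?_); norm_num

/-- [folklore] **`R_c`-SUM TWO-LEVEL RATE** (`pr ≠ 0`; `p`-order `−1` displayed):
`‖rCSum (N·Lc) N − rCSum N M‖ ≤ (567648·√D/√(momSq pr) + 1296)·coordConst Lc^D/N²`. -/
theorem norm_rCSum_two_level_le (hpr0 : pr ≠ 0) (κ : Fin D) (x' : Fin D → ℤ) :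
    ‖rCSum (N * Lc) N pr κ x' - rCSum N M pr κ x'‖ ≤
      (567648 * Real.sqrt D / Real.sqrt (momSq pr) + 1296) * coordConst Lc ^ D / (N : ℝ) ^ 2 := by
  have hN : 0 < N := by omega
  have hN2' : 2 ≤ N * Lc := le_trans hN2 (Nat.le_mul_of_pos_right N hLc)
  haveI : NeZero (N * Lc * Lc) := ⟨mul_ne_zero (NeZero.ne (N * Lc)) hLc.ne'⟩
  have hmp : 0 < momSq pr := by
    obtain ⟨i, hi⟩ : ∃ i, pr i ≠ 0 := by by_contra h; push Not at h; exact hpr0 (funext h)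
    exact lt_of_lt_of_le (by positivity : 0 < pr i ^ 2) (Finset.single_le_sum (fun j _ => sq_nonneg (pr j)) (Finset.mem_univ i))
  have hsp : 0 < Real.sqrt (momSq pr) := Real.sqrt_pos.2 hmp
  unfold rCSum
  have h := norm_sum_two_level_of_label (N := N) hLc hpr (fun m => rCNorm N M pr m κ x') (fun m' => rCNorm (N * Lc) N pr m' κ x')
    (by positivity : (0:ℝ) ≤ 567648 * Real.sqrt D / Real.sqrt (momSq pr)) (by norm_num : (0:ℝ) ≤ 1296)
    (fun m => by
      have hr := (rCNorm_label hN2 hM hLc hNM hpr m κ x').2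
      have hW : 0 ≤ ∏ i, wMaj Lc (qlab pr m i) := Finset.prod_nonneg fun i _ => wMaj_nonneg _ _
      have hgeo := momSq_le_mul_momSq_qlab (N := N) hpr m
      -- 1/√momSq(q) ≤ √D/√momSq(pr)
      have hmq : 0 < momSq (qlab pr m) := by
        rcases Nat.eq_zero_or_pos D with hD | hD
        · subst hD; exfalso; simp [momSq] at hmp
        · have hD' : (0:ℝ) < D := by exact_mod_cast hD
          nlinarith
      have hsq : 0 < Real.sqrt (momSq (qlab pr m)) := Real.sqrt_pos.2 hmq
      have hkey : Real.sqrt (momSq pr) ≤ Real.sqrt D * Real.sqrt (momSq (qlab pr m)) := by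
        rw [← Real.sqrt_mul (Nat.cast_nonneg D)]; exact Real.sqrt_le_sqrt hgeo
      refine hr.trans ?_
      rw [div_le_div_iff₀ (by positivity) (by positivity)]
      have hN' : (0:ℝ) < (N:ℝ) ^ 2 := by positivity
      calc 567648 * (∏ i, wMaj Lc (qlab pr m i)) * (N : ℝ) ^ 2
          = (567648 * (∏ i, wMaj Lc (qlab pr m i)) * (N : ℝ) ^ 2) * (Real.sqrt (momSq pr) / Real.sqrt (momSq pr)) := by
            rw [div_self hsp.ne', mul_one]
        _ ≤ (567648 * (∏ i, wMaj Lc (qlab pr m i)) * (N : ℝ) ^ 2) * (Real.sqrt D * Real.sqrt (momSq (qlab pr m)) / Real.sqrt (momSq pr)) := by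
            gcongr
        _ = 567648 * Real.sqrt D / Real.sqrt (momSq pr) * (∏ i, wMaj Lc (qlab pr m i)) * (Real.sqrt (momSq (qlab pr m)) * (N : ℝ) ^ 2) := by
            ring)
    (fun m' hm' => by
      obtain ⟨hmom, hs1, hq0⟩ := newLabel_facts hN2 hpr hm'
      have hb := (rCNorm_label (N := N * Lc) (M := N) (Lc := Lc) hN2' hN hLc rfl hpr m' κ x').1 hq0
      have hW : 0 ≤ ∏ i, wMaj Lc (qlab pr m' i) := Finset.prod_nonneg fun i _ => wMaj_nonneg _ _
      refine hb.trans (div_le_div_of_nonneg_left (by positivity) (by positivity) ?_)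
      calc (N : ℝ) ^ 2 = (N : ℝ) ^ 2 * 1 := by ring
        _ ≤ momSq (qlab pr m') * Real.sqrt (momSq (qlab pr m')) := mul_le_mul hmom hs1 zero_le_one ((sq_nonneg _).trans hmom))
  exact h

/-- [folklore] **`S_c`-SUM TWO-LEVEL RATE** (`pr ≠ 0`): `‖sCSum (N·Lc) N − sCSum N M‖ ≤ (567648·√D/√(momSq pr) + 1296)·coordConst Lc^D/N²`. -/
theorem norm_sCSum_two_level_le (hpr0 : pr ≠ 0) (l : Fin D) (y' : Fin D → ℤ) :
    ‖sCSum (N * Lc) N pr l y' - sCSum N M pr l y'‖ ≤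
      (567648 * Real.sqrt D / Real.sqrt (momSq pr) + 1296) * coordConst Lc ^ D / (N : ℝ) ^ 2 := by
  have hN : 0 < N := by omega
  have hN2' : 2 ≤ N * Lc := le_trans hN2 (Nat.le_mul_of_pos_right N hLc)
  haveI : NeZero (N * Lc * Lc) := ⟨mul_ne_zero (NeZero.ne (N * Lc)) hLc.ne'⟩
  have hmp : 0 < momSq pr := by
    obtain ⟨i, hi⟩ : ∃ i, pr i ≠ 0 := by by_contra h; push Not at h; exact hpr0 (funext h)
    exact lt_of_lt_of_le (by positivity : 0 < pr i ^ 2) (Finset.single_le_sum (fun j _ => sq_nonneg (pr j)) (Finset.mem_univ i))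
  have hsp : 0 < Real.sqrt (momSq pr) := Real.sqrt_pos.2 hmp
  unfold sCSum
  have h := norm_sum_two_level_of_label (N := N) hLc hpr (fun m => sCNorm N M pr m l y') (fun m' => sCNorm (N * Lc) N pr m' l y')
    (by positivity : (0:ℝ) ≤ 567648 * Real.sqrt D / Real.sqrt (momSq pr)) (by norm_num : (0:ℝ) ≤ 1296)
    (fun m => by
      have hr := (sCNorm_label hN2 hM hLc hNM hpr m l y').2
      have hW : 0 ≤ ∏ i, wMaj Lc (qlab pr m i) := Finset.prod_nonneg fun i _ => wMaj_nonneg _ _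
      have hgeo := momSq_le_mul_momSq_qlab (N := N) hpr m
      have hmq : 0 < momSq (qlab pr m) := by
        rcases Nat.eq_zero_or_pos D with hD | hD
        · subst hD; exfalso; simp [momSq] at hmp
        · have hD' : (0:ℝ) < D := by exact_mod_cast hD
          nlinarith
      have hsq : 0 < Real.sqrt (momSq (qlab pr m)) := Real.sqrt_pos.2 hmq
      have hkey : Real.sqrt (momSq pr) ≤ Real.sqrt D * Real.sqrt (momSq (qlab pr m)) := by
        rw [← Real.sqrt_mul (Nat.cast_nonneg D)]; exact Real.sqrt_le_sqrt hgeo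
      refine hr.trans ?_
      rw [div_le_div_iff₀ (by positivity) (by positivity)]
      calc 567648 * (∏ i, wMaj Lc (qlab pr m i)) * (N : ℝ) ^ 2
          = (567648 * (∏ i, wMaj Lc (qlab pr m i)) * (N : ℝ) ^ 2) * (Real.sqrt (momSq pr) / Real.sqrt (momSq pr)) := by
            rw [div_self hsp.ne', mul_one]
        _ ≤ (567648 * (∏ i, wMaj Lc (qlab pr m i)) * (N : ℝ) ^ 2) * (Real.sqrt D * Real.sqrt (momSq (qlab pr m)) / Real.sqrt (momSq pr)) := by
            gcongr
        _ = 567648 * Real.sqrt D / Real.sqrt (momSq pr) * (∏ i, wMaj Lc (qlab pr m i)) * (Real.sqrt (momSq (qlab pr m)) * (N : ℝ) ^ 2) := by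
            ring)
    (fun m' hm' => by
      obtain ⟨hmom, hs1, hq0⟩ := newLabel_facts hN2 hpr hm'
      have hb := (sCNorm_label (N := N * Lc) (M := N) (Lc := Lc) hN2' hN hLc rfl hpr m' l y').1 hq0
      have hW : 0 ≤ ∏ i, wMaj Lc (qlab pr m' i) := Finset.prod_nonneg fun i _ => wMaj_nonneg _ _
      refine hb.trans (div_le_div_of_nonneg_left (by positivity) (by positivity) ?_)
      calc (N : ℝ) ^ 2 = (N : ℝ) ^ 2 * 1 := by ring
        _ ≤ momSq (qlab pr m') * Real.sqrt (momSq (qlab pr m')) := mul_le_mul hmom hs1 zero_le_one ((sq_nonneg _).trans hmom))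
  exact h

end Total

end Summit.QuantumFields.BalabanUV.Beta.GAN24.FibreRateFeedTotal

end
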